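import Summits.ResolutionOfSingularities.ResolutionOfSingularities.Theorems.HomologicalConductorNoZenoTransversal
import Summits.ResolutionOfSingularities.ResolutionOfSingularities.Theorems.HomologicalConductorNoZenoDuValFamilies
import Literature.AlgebraicGeometry.Motives.CartierDivisorProperIntersection
import Literature.AlgebraicGeometry.Resolution.ExceptionalCurvePoints
import HarnessLib

/-!
# Crux `NoZenoR` (stmt-ResolutionOfSingularities-19943), facts slot `Lipman1969_14_1`: SYMMETRY of the intersection
# numbers of two distinct exceptional curves, `(E_{η'}·E_η) = (E_η·E_{η'})`, and Lipman's Lemma (14.1) FACT-FREE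

Route `ResolutionOfSingularities/HomologicalConductor` (cell decomp-res, hand leafhand-res-homologicalconduct-9 g0).
OURS: AI-written bookkeeping, weaker than expert review; nothing here is a statement of the manuscript under review
(Hironaka 2017).  SUPPORT level, counted 0.  Def-free, FACT-FREE.

For a desingularization `π : X → Spec S` of a two-dimensional normal Noetherian local domain and two DISTINCT integral
exceptional curves `E_η ≠ E_{η'}` (prime divisors `[E_η] = ofIsEffectiveCartier 𝓘_η`), Lipman's intersection numbers
`(E_{η'}·E_η) = deg_{κ(𝔪)}([E_{η'}]|_{E_η})` and `(E_η·E_{η'})` agree.  This is the symmetric clause "`= (E·F)`" of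
Lipman 1969, Prop. (13.1) d), obtained here WITHOUT cohomology, through Fulton's local identity (*Intersection Theory*,
Thm. 2.4, Case 1 of the proof, Lemmas A.2.7–A.2.8; tree `Literature.RingTheory.Length.finsum_ord_mul_ord_comm`):
both numbers are `Σ_w [κ(w) : κ(𝔪)] · ℓ(𝒪_{X,w}/(t_w, t'_w))`-shaped sums over the common points `w`, where at `w` the
local equations `t_w, t'_w ∈ A = 𝒪_{X,w}` GENERATE the height-one primes `𝔭_η, 𝔭_{η'}` of the two curves, so that
Fulton's sums `Σ_{P ⊇ (t')} ord_{A_P}(t')·ord_{A/P}(t̄)` collapse to `ord_{A_{𝔭'}}(t')·ord_{A/𝔭'}(t̄) = 1·ord_{A/𝔭'}(t̄)`.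

* `toFunctionField_germ_cartierGen`, `span_germ_cartierGen` — the germ of the chart generator of
  `ofIsEffectiveCartier I` at `w` is a local equation and generates `I_w`;
* `ordAt_ofIsEffectiveCartier_primeDivisorIdeal_self` — `ord_η [E_η] = 1` on a regular `X`;
* `excCurveDegree_eq_finsum_dite` — `(𝒪(D)·E_η)` as a sum over the points `w` of `X` (`η ⤳ w`);
* `ordAt_pullbackRep_primeDivisor_eq` / `…_eq_zero` — the local term of `(E_{η'}·E_η)` at `w` is
  `ord_{A/𝔭_η}(t̄')` (resp. `0` off `E_{η'}`);
* `ord_quotient_comm_of_span_eq` — the ring-theoretic symmetry `ord_{A/P}(t̄') = ord_{A/P'}(t̄)`;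
* **`excCurveDegree_primeDivisor_comm`** — `(E_{η'}·E_η) = (E_η·E_{η'})`;
* **`lipman1969_14_1_factFree`** — Lipman's Lemma (14.1) for finite families, universe `0`, NO hypotheses beyond the
  typed binders (from `lipman1969_14_1_of_comm`, p812485), and **`lipman1969_14_1_holds_univ0 : Lipman1969_14_1.{0}`**.

References: J. Lipman, Publ. Math. IHÉS 36 (1969), Lemma (14.1) p. 224, Prop. (13.1) p. 223 [`Lipman1969`];
W. Fulton, *Intersection Theory* (2nd ed. 1998), Thm. 2.4 (Case 1, p. 36), Lemmas A.2.7–A.2.8 [`Fulton1998`].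
-/

noncomputable section

-- single-problem summit: the doubled namespace component `ResolutionOfSingularities` is forced
set_option linter.dupNamespace false

namespace Summit.ResolutionOfSingularities.ResolutionOfSingularities.Theorems.NoZeno.ExcCount

open CategoryTheory AlgebraicGeometry TopologicalSpace IsLocalRing Order
open Literature.AlgebraicGeometry.Resolution Literature.AlgebraicGeometry.Motives
open Literature.AlgebraicGeometry.Motives.RatFn

universe u

/-! ## §1 Germs of chart generators -/

section Germs

variable {X : Scheme.{u}} [IsIntegral X]

/-- The germ at `w` of the chart generator of `ofIsEffectiveCartier I` is a local equation at `w` (as a rational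
function it is the chart's local equation). [cite: GortzWedhorn2020, Remark 11.27 and (11.12) (pp. 378–379)] -/
theorem toFunctionField_germ_cartierGen (I : X.IdealSheafData) (hI : IsEffectiveCartier I) (w : X) :
    toFunctionField w (X.presheaf.germ (CartierDivisor.cartierChart I hI w : X.Opens) w
        (CartierDivisor.mem_cartierChart I hI w) (CartierDivisor.cartierGen I hI w)) =
      (CartierDivisor.ofIsEffectiveCartier I hI).f w := by
  rw [CartierDivisor.ofIsEffectiveCartier_f]
  exact toFunctionField_germ_eq_secFn _ _ _

omit [IsIntegral X] in
/-- The germ at `w` of the chart generator of `ofIsEffectiveCartier I` generates the stalk ideal `I_w`.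
[cite: GortzWedhorn2020, Remark 11.27 and (11.12) (pp. 378–379)] -/
theorem span_germ_cartierGen (I : X.IdealSheafData) (hI : IsEffectiveCartier I) (w : X) :
    Ideal.span {X.presheaf.germ (CartierDivisor.cartierChart I hI w : X.Opens) w
        (CartierDivisor.mem_cartierChart I hI w) (CartierDivisor.cartierGen I hI w)} = stalkIdeal I w := by
  rw [stalkIdeal_eq_map_germ I (CartierDivisor.cartierChart I hI w) (CartierDivisor.mem_cartierChart I hI w),
    CartierDivisor.ideal_cartierChart, Ideal.map_span, Set.image_singleton]

/-- **`ord_η [E_η] = 1`**: on a regular integral scheme the prime divisor of a codimension-one point `η` has order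
one at `η` (its local equation generates the maximal ideal of the discrete valuation ring `𝒪_{X,η}`).
[cite: GortzWedhorn2020, Thm. 11.40 (2)] -/
theorem ordAt_ofIsEffectiveCartier_primeDivisorIdeal_self [IsLocallyNoetherian X] (hX : Scheme.IsRegular X)
    {η : X} (hη : coheight η = 1) (hc : IsEffectiveCartier (primeDivisorIdeal η)) :
    (CartierDivisor.ofIsEffectiveCartier (primeDivisorIdeal η) hc).ordAt η = 1 := by
  set t := X.presheaf.germ (CartierDivisor.cartierChart _ hc η : X.Opens) η
    (CartierDivisor.mem_cartierChart _ hc η) (CartierDivisor.cartierGen _ hc η) with ht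
  have hspan : Ideal.span {t} = maximalIdeal (X.presheaf.stalk η) := by
    rw [ht, span_germ_cartierGen, stalkIdeal_primeDivisorIdeal_self]
  have ht0 : t ≠ 0 := by
    intro h0
    apply (CartierDivisor.ofIsEffectiveCartier (primeDivisorIdeal η) hc).f_ne_zero η
    rw [← toFunctionField_germ_cartierGen, ← ht, h0, map_zero]
  haveI : IsPrincipalIdealRing (X.presheaf.stalk η) := isPrincipalIdealRing_stalk_of_coheight_eq_one hX hη
  have hprime : Prime t := by
    rw [← Ideal.span_singleton_prime ht0, hspan]
    exact (maximalIdeal.isMaximal _).isPrime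
  rw [(CartierDivisor.ofIsEffectiveCartier (primeDivisorIdeal η) hc).ordAt_eq_ord (i := η)
      (CartierDivisor.mem_cartierChart _ hc η), ← toFunctionField_germ_cartierGen, ← ht,
    Scheme.ord_toFunctionField_eq_toNat hη ht0, Ring.ord_of_irreducible hprime.irreducible]
  rfl

end Germs

/-! ## §2 The local algebra: `ord_{A/P}(t̄') = ord_{A/P'}(t̄)` for generators of distinct height-one primes -/

/-- **Fulton's local symmetry for GENERATORS of primes.**  In a Noetherian domain `A`, let `t, t'` be non-zero with
`(t) = P`, `(t') = P'` prime, `t ∉ P'`, `t' ∉ P`, `dim A/(t), dim A/(t') ≤ 1`, and `ord_{A_P}(t) = ord_{A_{P'}}(t') = 1`.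
Then `ord_{A/P}(t̄') = ord_{A/P'}(t̄)` (both are `ℓ(A/(t,t'))`; from `finsum_ord_mul_ord_comm`, Fulton Thm. 2.4 Case 1,
whose sums over the primes minimal over `(t')`, `(t)` have the single terms `P'`, `P`).
[cite: Fulton1998, Theorem 2.4 (Case 1 of the proof, p. 36)] -/
theorem ord_quotient_comm_of_span_eq {A : Type u} [CommRing A] [IsDomain A] [IsNoetherianRing A] {t t' : A}
    (ht0 : t ≠ 0) (ht'0 : t' ≠ 0) {P P' : Ideal A} [P.IsPrime] [P'.IsPrime] (hP : Ideal.span {t} = P)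
    (hP' : Ideal.span {t'} = P') (htP' : t ∉ P') (ht'P : t' ∉ P)
    [Ring.KrullDimLE 1 (A ⧸ Ideal.span {t'})] [Ring.KrullDimLE 1 (A ⧸ Ideal.span {t})]
    (h1 : Ring.ord (Localization.AtPrime P) (algebraMap A (Localization.AtPrime P) t) = 1)
    (h1' : Ring.ord (Localization.AtPrime P') (algebraMap A (Localization.AtPrime P') t') = 1) :
    Ring.ord (A ⧸ P) (Ideal.Quotient.mk P t') = Ring.ord (A ⧸ P') (Ideal.Quotient.mk P' t) := by
  have hmin : (Ideal.span {t}).minimalPrimes = {P} := by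
    rw [hP]; exact Ideal.minimalPrimes_eq_subsingleton_self
  have hmin' : (Ideal.span {t'}).minimalPrimes = {P'} := by
    rw [hP']; exact Ideal.minimalPrimes_eq_subsingleton_self
  have hab : ∀ Q ∈ (Ideal.span {t'}).minimalPrimes, t ∉ Q := fun Q hQ => by
    rw [hmin', Set.mem_singleton_iff] at hQ
    rw [hQ]; exact htP'
  have hba : ∀ Q ∈ (Ideal.span {t}).minimalPrimes, t' ∉ Q := fun Q hQ => by
    rw [hmin, Set.mem_singleton_iff] at hQ
    rw [hQ]; exact ht'P
  have key := Literature.RingTheory.Length.finsum_ord_mul_ord_comm ht0 ht'0 hab hba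
  have hset : {Q : PrimeSpectrum A | Q.asIdeal ∈ (Ideal.span {t}).minimalPrimes} = {⟨P, inferInstance⟩} := by
    ext Q
    simp only [Set.mem_setOf_eq, hmin, Set.mem_singleton_iff, PrimeSpectrum.ext_iff]
  have hset' : {Q : PrimeSpectrum A | Q.asIdeal ∈ (Ideal.span {t'}).minimalPrimes} = {⟨P', inferInstance⟩} := by
    ext Q
    simp only [Set.mem_setOf_eq, hmin', Set.mem_singleton_iff, PrimeSpectrum.ext_iff]
  rw [hset, hset', finsum_mem_singleton, finsum_mem_singleton] at key
  change Ring.ord (Localization.AtPrime P') (algebraMap A (Localization.AtPrime P') t') *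
      Ring.ord (A ⧸ P') (Ideal.Quotient.mk P' t) =
    Ring.ord (Localization.AtPrime P) (algebraMap A (Localization.AtPrime P) t) *
      Ring.ord (A ⧸ P) (Ideal.Quotient.mk P t') at key
  rw [h1, h1', one_mul, one_mul] at key
  exact key.symm

/-! ## §3 Intersection numbers as sums over the points of `X`; the local terms -/

section Terms

variable {T : Type u} [CommRing T] [IsLocalRing T] {X : Scheme.{u}} [IsIntegral X] [IsLocallyNoetherian X]
  (π : X ⟶ Spec (.of T))

omit [IsLocalRing T] in
open scoped Classical in
/-- **`(𝒪_X(D)·E_η)` as a sum over the points `w` of `X`**: the defining sum over the points of the subscheme `E_η`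
re-indexed along the injection `E_η ↪ X` (`ofPointPt η h` is the point over `w` for `η ⤳ w`; the residue degree along
`E_η → X → Spec T` is that along `π`). [cite: Lipman1969, Section 12 (p. 220) with Section 10 (p. 212)] -/
theorem excCurveDegree_eq_finsum_dite (D : CartierDivisor X) (η : X) :
    excCurveDegree π D η = ∑ᶠ w : X, (if h : η ⤳ w then
      (D.pullbackRep (ClosedSubvariety.ofPoint X η).ι).ordAt (ClosedSubvariety.ofPointPt η h) *
        ((π.residueDegree w : ℕ) : ℤ) else 0) := by
  classical
  set V := ClosedSubvariety.ofPoint X η with hV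
  set G : X → ℤ := fun w => if h : η ⤳ w then
      (D.pullbackRep V.ι).ordAt (ClosedSubvariety.ofPointPt η h) * ((π.residueDegree w : ℕ) : ℤ) else 0 with hG
  have hinj : Function.Injective V.ι.base := V.ι.isClosedEmbedding.injective
  have hGι : ∀ y : V.carrier, G (V.ι.base y) =
      (D.pullbackRep V.ι).ordAt y * ((((V.ι ≫ π).residueDegree y : ℕ)) : ℤ) := by
    intro y
    have hy : η ⤳ V.ι.base y := ClosedSubvariety.specializes_ofPoint_ι η y
    have hpt : ClosedSubvariety.ofPointPt η hy = y := Subtype.ext rfl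
    have h1 : G (V.ι.base y) = (D.pullbackRep V.ι).ordAt (ClosedSubvariety.ofPointPt η hy) *
        ((π.residueDegree (V.ι.base y) : ℕ) : ℤ) := by
      rw [hG]
      exact dif_pos hy
    rw [h1, ← residueDegree_ι_comp_ofPointPt π hy, hpt]
  unfold excCurveDegree
  calc ∑ᶠ y : V.carrier, (D.pullbackRep V.ι).ordAt y * ((((V.ι ≫ π).residueDegree y : ℕ)) : ℤ)
      = ∑ᶠ y : V.carrier, G (V.ι.base y) := finsum_congr fun y => (hGι y).symm
    _ = ∑ᶠ w ∈ Set.range V.ι.base, G w := (finsum_mem_range hinj).symm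
    _ = ∑ᶠ w, G w := by
        rw [finsum_mem_def]
        congr 1
        refine Set.indicator_eq_self.2 fun w hw => ?_
        by_contra hrange
        apply hw
        have hnw : ¬ η ⤳ w := fun h => hrange ⟨ClosedSubvariety.ofPointPt η h, rfl⟩
        rw [hG]
        exact dif_neg hnw

/-- **The local term of `(E_{η'}·E_η)` at a point `w ≠ η` of `E_η` is `ord_{𝒪_{X,w}/𝔭_η}(t̄'_w)`**, `t'_w` the germ
of the chart generator of `𝓘_{η'}` at `w` (Fulton, Thm. 2.4 Case 1: "the coefficient of `[W]` in `D · [V]` is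
`ℓ_{A/p}(A/p + aA)`"; tree `ordAt_pullbackAvoiding_ofPoint_eq_toNat_ord_quotient`).
[cite: Fulton1998, Theorem 2.4 (Case 1 of the proof, p. 36)] -/
theorem ordAt_pullbackRep_primeDivisor_eq [IsProper π] {η η' w : X} (hη : η ∈ excCurvePoints π)
    (hη'η : ¬ η' ⤳ η) (h : η ⤳ w) (hwη : w ≠ η) (hc' : IsEffectiveCartier (primeDivisorIdeal η')) :
    ((CartierDivisor.ofIsEffectiveCartier (primeDivisorIdeal η') hc').pullbackRep
        (ClosedSubvariety.ofPoint X η).ι).ordAt (ClosedSubvariety.ofPointPt η h) =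
      ((Ring.ord (X.presheaf.stalk w ⧸ primeOfSpecializes h)
        (Ideal.Quotient.mk _ (X.presheaf.germ (CartierDivisor.cartierChart _ hc' w : X.Opens) w
          (CartierDivisor.mem_cartierChart _ hc' w) (CartierDivisor.cartierGen _ hc' w)))).toNat : ℤ) := by
  have hav := avoids_ι_genericPoint_ofPoint (X := X) (η := η) hη'η hc'
  rw [CartierDivisor.pullbackRep_of_avoids _ _ hav]
  obtain ⟨q, hq⟩ := exists_fac_specResidueField π hη.1
  haveI : IsIntegral (Over.mk q : SchemeOver (ResidueField T)).left :=
    inferInstanceAs (IsIntegral (ClosedSubvariety.ofPoint X η).carrier)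
  haveI : IsProper (Over.mk q : SchemeOver (ResidueField T)).hom := isProper_of_fac_specResidueField π hq
  have hcoh : coheight (ClosedSubvariety.ofPointPt η h) = 1 :=
    CartierDivisor.coheight_eq_one_of_height_eq_zero (C := (Over.mk q : SchemeOver (ResidueField T)))
      (height_top_ofPoint_eq_one π hη) (height_ofPointPt_eq_zero π hη h hwη)
  have hD : (CartierDivisor.ofIsEffectiveCartier (primeDivisorIdeal η') hc').Avoids η :=
    (CartierDivisor.avoids_ofIsEffectiveCartier_iff _ hc' η).2 (by rwa [mem_support_primeDivisorIdeal_iff])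
  have htz := (CartierDivisor.avoids_iff_notMem_of_eq (i := w) h (CartierDivisor.mem_cartierChart _ hc' w)
    (toFunctionField_germ_cartierGen _ hc' w)).1 hD
  exact CartierDivisor.ordAt_pullbackAvoiding_ofPoint_eq_toNat_ord_quotient (i := w) h
    (CartierDivisor.mem_cartierChart _ hc' w) (toFunctionField_germ_cartierGen _ hc' w) hav hcoh htz

/-- Off `E_{η'}` the local term of `(E_{η'}·E_η)` vanishes: for `η ⤳ w` with `η' ̸⤳ w` the restricted divisor
`[E_{η'}]|_{E_η}` avoids the point over `w`. [cite: Fulton1998, Definition 1.4] -/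
theorem ordAt_pullbackRep_primeDivisor_eq_zero {η η' w : X} (hη'η : ¬ η' ⤳ η) (h : η ⤳ w) (hw : ¬ η' ⤳ w)
    (hc' : IsEffectiveCartier (primeDivisorIdeal η')) :
    ((CartierDivisor.ofIsEffectiveCartier (primeDivisorIdeal η') hc').pullbackRep
        (ClosedSubvariety.ofPoint X η).ι).ordAt (ClosedSubvariety.ofPointPt η h) = 0 := by
  have hav := avoids_ι_genericPoint_ofPoint (X := X) (η := η) hη'η hc'
  rw [CartierDivisor.pullbackRep_of_avoids _ _ hav]
  have hDw : (CartierDivisor.ofIsEffectiveCartier (primeDivisorIdeal η') hc').Avoids w :=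
    (CartierDivisor.avoids_ofIsEffectiveCartier_iff _ hc' w).2 (by rwa [mem_support_primeDivisorIdeal_iff])
  have hav' : ((CartierDivisor.ofIsEffectiveCartier (primeDivisorIdeal η') hc').pullbackAvoiding
      (ClosedSubvariety.ofPoint X η).ι hav).Avoids (ClosedSubvariety.ofPointPt η h) :=
    fun i hi => (hDw i.1 hi).pullbackFn
  exact hav'.ordAt_eq_zero

end Terms

/-! ## §4 Symmetry and Lemma (14.1) -/

section Symmetry

variable {S : Type u} [CommRing S] [IsNoetherianRing S] [IsLocalRing S] [IsDomain S] [IsIntegrallyClosed S]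
  {X : Scheme.{u}} [IsIntegral X] [IsLocallyNoetherian X] {π : X ⟶ Spec (.of S)}

omit [IsIntegrallyClosed S] in
/-- **`(E_{η'}·E_η) = (E_η·E_{η'})` for distinct integral exceptional curves** of a desingularization of a
two-dimensional normal Noetherian local domain (the symmetric clause "`= (E·F)`" of Lipman's Prop. (13.1) d), via
Fulton's local identity, Thm. 2.4 Case 1). [cite: Lipman1969, Proposition (13.1) d) (p. 223)]
[cite: Fulton1998, Theorem 2.4 (Case 1 of the proof, p. 36)] -/
theorem excCurveDegree_primeDivisor_comm (h2 : ringKrullDim S = 2) (hπ : IsResolution π) {η η' : X}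
    (hη : η ∈ excCurvePoints π) (hη' : η' ∈ excCurvePoints π) (hne : η ≠ η')
    (hc : IsEffectiveCartier (primeDivisorIdeal η)) (hc' : IsEffectiveCartier (primeDivisorIdeal η')) :
    excCurveDegree π (CartierDivisor.ofIsEffectiveCartier (primeDivisorIdeal η') hc') η =
      excCurveDegree π (CartierDivisor.ofIsEffectiveCartier (primeDivisorIdeal η) hc) η' := by
  classical
  haveI : IsProper π := hπ.isProper
  have hX : Scheme.IsRegular X := hπ.isRegular
  have hco : coheight η = 1 := hπ.coheight_eq_one_of_mem_excCurvePoints h2 hη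
  have hco' : coheight η' = 1 := hπ.coheight_eq_one_of_mem_excCurvePoints h2 hη'
  -- distinct codimension-one points do not specialise to one another
  have hnsp : ∀ z w : X, coheight z = 1 → coheight w = 1 → z ≠ w → ¬ z ⤳ w := by
    intro z w hz hw hzw hsp
    have hlt : w < z := ⟨Scheme.le_iff_specializes.2 hsp,
      fun h' => hzw (((Scheme.le_iff_specializes.1 h').antisymm hsp).eq).symm⟩
    have h1 := Order.coheight_add_one_le hlt
    rw [hz, hw] at h1
    exact absurd h1 (by decide)
  have hηη' : ¬ η ⤳ η' := hnsp η η' hco hco' hne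
  have hη'η : ¬ η' ⤳ η := hnsp η' η hco' hco (Ne.symm hne)
  set D := CartierDivisor.ofIsEffectiveCartier (primeDivisorIdeal η) hc with hDdef
  set D' := CartierDivisor.ofIsEffectiveCartier (primeDivisorIdeal η') hc' with hD'def
  rw [excCurveDegree_eq_finsum_dite π D' η, excCurveDegree_eq_finsum_dite π D η']
  refine finsum_congr fun w => ?_
  by_cases h : η ⤳ w
  · by_cases h' : η' ⤳ w
    · -- a common point `w ≠ η, η'`
      have hwη : w ≠ η := fun e => hη'η (e ▸ h')
      have hwη' : w ≠ η' := fun e => hηη' (e ▸ h)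
      rw [dif_pos h, dif_pos h', hD'def, ordAt_pullbackRep_primeDivisor_eq π hη hη'η h hwη hc', hDdef,
        ordAt_pullbackRep_primeDivisor_eq π hη' hηη' h' hwη' hc]
      congr 2
      -- the two local equations at `w`
      set t := X.presheaf.germ (CartierDivisor.cartierChart _ hc w : X.Opens) w
        (CartierDivisor.mem_cartierChart _ hc w) (CartierDivisor.cartierGen _ hc w) with ht
      set t' := X.presheaf.germ (CartierDivisor.cartierChart _ hc' w : X.Opens) w
        (CartierDivisor.mem_cartierChart _ hc' w) (CartierDivisor.cartierGen _ hc' w) with ht'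
      have htf : toFunctionField w t = D.f w := toFunctionField_germ_cartierGen _ hc w
      have htf' : toFunctionField w t' = D'.f w := toFunctionField_germ_cartierGen _ hc' w
      have hP : Ideal.span {t} = primeOfSpecializes h := by
        rw [ht, span_germ_cartierGen, stalkIdeal_primeDivisorIdeal h]
      have hP' : Ideal.span {t'} = primeOfSpecializes h' := by
        rw [ht', span_germ_cartierGen, stalkIdeal_primeDivisorIdeal h']
      have ht0 : t ≠ 0 := by
        intro h0; apply D.f_ne_zero w; rw [← htf, h0, map_zero]
      have ht'0 : t' ≠ 0 := by
        intro h0; apply D'.f_ne_zero w; rw [← htf', h0, map_zero]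
      have hDη' : D.Avoids η' :=
        (CartierDivisor.avoids_ofIsEffectiveCartier_iff _ hc η').2 (by rwa [mem_support_primeDivisorIdeal_iff])
      have hD'η : D'.Avoids η :=
        (CartierDivisor.avoids_ofIsEffectiveCartier_iff _ hc' η).2 (by rwa [mem_support_primeDivisorIdeal_iff])
      have htP' : t ∉ primeOfSpecializes h' :=
        (CartierDivisor.avoids_iff_notMem_of_eq (i := w) h' (CartierDivisor.mem_cartierChart _ hc w) htf).1 hDη'
      have ht'P : t' ∉ primeOfSpecializes h :=
        (CartierDivisor.avoids_iff_notMem_of_eq (i := w) h (CartierDivisor.mem_cartierChart _ hc' w) htf').1 hD'η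
      -- `dim 𝒪_{X,w} ≤ 2`, so the quotients by `t`, `t'` have dimension `≤ 1`
      have hdimA : ringKrullDim (X.presheaf.stalk w) ≤ 2 := by
        rw [ringKrullDim_stalk_eq_coheight w]
        have hle := IsResolution.height_add_coheight_le_two h2.le hπ w
        have hco2 : coheight w ≤ 2 := le_trans le_add_self hle
        rw [← WithBot.coe_ofNat, WithBot.coe_le_coe]
        exact hco2
      have hdim : ∀ {x : X.presheaf.stalk w}, x ≠ 0 →
          Ring.KrullDimLE 1 (X.presheaf.stalk w ⧸ Ideal.span {x}) := by
        intro x hx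
        rw [Ring.krullDimLE_iff]
        have h3 : ringKrullDim (X.presheaf.stalk w ⧸ Ideal.span {x}) + 1 ≤
            ringKrullDim (X.presheaf.stalk w) :=
          ringKrullDim_quotient_succ_le_of_nonZeroDivisor (mem_nonZeroDivisors_of_ne_zero hx)
        have h4 := h3.trans hdimA
        rw [show (2 : WithBot ℕ∞) = 1 + 1 from rfl] at h4
        exact ENat.WithBot.add_le_add_one_right_iff.mp h4
      haveI := hdim ht0
      haveI := hdim ht'0
      -- `ord_{A_𝔭}(t) = 1 = ord_{A_{𝔭'}}(t')`
      have h1 : Ring.ord (Localization.AtPrime (primeOfSpecializes h))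
          (algebraMap _ (Localization.AtPrime (primeOfSpecializes h)) t) = 1 := by
        have e1 := ordAt_ofIsEffectiveCartier_primeDivisorIdeal_self hX hco hc
        rw [CartierDivisor.ordAt_eq_toNat_ord_localization (i := w) h (CartierDivisor.mem_cartierChart _ hc w)
          htf hco] at e1
        have e2 : (Ring.ord (Localization.AtPrime (primeOfSpecializes h))
            (algebraMap _ (Localization.AtPrime (primeOfSpecializes h)) t)).toNat = 1 := by exact_mod_cast e1
        exact (ENat.toNat_eq_iff one_ne_zero).mp e2
      have h1' : Ring.ord (Localization.AtPrime (primeOfSpecializes h'))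
          (algebraMap _ (Localization.AtPrime (primeOfSpecializes h')) t') = 1 := by
        have e1 := ordAt_ofIsEffectiveCartier_primeDivisorIdeal_self hX hco' hc'
        rw [CartierDivisor.ordAt_eq_toNat_ord_localization (i := w) h' (CartierDivisor.mem_cartierChart _ hc' w)
          htf' hco'] at e1
        have e2 : (Ring.ord (Localization.AtPrime (primeOfSpecializes h'))
            (algebraMap _ (Localization.AtPrime (primeOfSpecializes h')) t')).toNat = 1 := by exact_mod_cast e1
        exact (ENat.toNat_eq_iff one_ne_zero).mp e2
      rw [ord_quotient_comm_of_span_eq ht0 ht'0 hP hP' htP' ht'P h1 h1']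
    · rw [dif_pos h, dif_neg h', hD'def, ordAt_pullbackRep_primeDivisor_eq_zero hη'η h h' hc', zero_mul]
  · by_cases h' : η' ⤳ w
    · rw [dif_neg h, dif_pos h', hDdef, ordAt_pullbackRep_primeDivisor_eq_zero hηη' h' h hc, zero_mul]
    · rw [dif_neg h, dif_neg h']

end Symmetry

/-- **Lipman 1969, Lemma (14.1), for finite families — FACT-FREE** (universe `0`): for a desingularization
`π : X → Spec S` of a two-dimensional normal Noetherian local domain, a finite set `F` of generic points of integral
exceptional curves and `y : F → ℤ`, `y ≠ 0`: `Σ_i Σ_j y_i y_j (E_j·E_i) < 0`.  (`lipman1969_14_1_of_comm` with the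
symmetry `excCurveDegree_primeDivisor_comm`.) [cite: Lipman1969, Lemma (14.1) (p. 224)] -/
theorem lipman1969_14_1_factFree {S : Type} [CommRing S] [IsNoetherianRing S] [IsLocalRing S] [IsDomain S]
    [IsIntegrallyClosed S] (h2 : ringKrullDim S = 2) {X : Scheme.{0}} [IsIntegral X] [IsLocallyNoetherian X]
    {π : X ⟶ Spec (.of S)} (hπ : IsResolution π) (F : Finset X) (hF : ∀ η ∈ F, η ∈ excCurvePoints π)
    (hc : ∀ η ∈ F, IsEffectiveCartier (primeDivisorIdeal η)) (y : {η // η ∈ F} → ℤ) (hy : y ≠ 0) :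
    ∑ i, ∑ j, y i * y j *
      excCurveDegree π (CartierDivisor.ofIsEffectiveCartier (primeDivisorIdeal (j : X)) (hc j j.2)) i < 0 :=
  lipman1969_14_1_of_comm h2 hπ F hF hc
    (fun i j hij => excCurveDegree_primeDivisor_comm h2 hπ (hF i i.2) (hF j j.2) hij (hc i i.2) (hc j j.2)) y hy

/-- **The typed named fact `Lipman1969_14_1` at universe `0` is a THEOREM** (negative definiteness of the
intersection matrix of the exceptional curves; du Val, Mumford). [cite: Lipman1969, Lemma (14.1) (p. 224)] -/
theorem lipman1969_14_1_holds_univ0 : Lipman1969_14_1.{0} := by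
  intro S _ _ _ _ _ h2 X _ _ π hπ F hF hc y hy
  exact lipman1969_14_1_factFree h2 hπ F hF hc y hy

end Summit.ResolutionOfSingularities.ResolutionOfSingularities.Theorems.NoZeno.ExcCount

end
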